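import Summits.BirchSwinnertonDyer.BirchSwinnertonDyer.Theorems.ErratumRoadFiveTateTorsionRigidity
import Literature.NumberTheory.GaloisRepresentations.LocalGaloisGroupProofs
import Literature.NumberTheory.EllipticCurves.BigGaloisRepSelmer
import HarnessLib

/-!
# Crux 4 `BSDpOnCellC` (stmt-BirchSwinnertonDyer-19034), line `telescope`, leaf N2 / sub-leaf W2: THE KUMMER ARGUMENT BEHIND THE TWISTED TATE
# UNIFORMISATION — `H`-fixed `p`-power torsion values of a twisted parametrisation `Ψ : K̄^× → E` with kernel `q^ℤ` are multiples of
# `Ψ(r)`, `q = r^{p^k}` (helper, `--supports stmt-BirchSwinnertonDyer-19034 --as helper`; closes nothing; NOT the registered text)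

Cell `bsd-eis`, width seat `bsd-line-x2-p2` (prover g20, 2026-08-30; D-0154 KEY row 5). THEOREMS ONLY: no definition, no named fact,
no `sorry`, no instance, no notation. The algebraic core of the NON-SPLIT (indeed sign-uniform) twin of bsd-stepL's (L1)
(`TateTorsionRigidity`, `LocalTorsionDegreeOne`): the sibling file `…TelescopeK2FixedTorsionFiniteMult` feeds it with the tree's PROVED twisted
uniformisation `TateCurve.Silverman1994_thmV53_corV54_tateUniformisation_holds` at a multiplicative degree-one prime and concludes the
finiteness input (hfin𝔮)/(hfinK) of W2 (`TelescopeK2FixedTorsionFiniteSplitMult`, p748758) WITHOUT the split hypothesis.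

SETTING (§3). `F` a field of characteristic `0`, `p` an odd prime; `H ⊴ Γ_F` with `μ_p(F̄^H) = 1`; `I ≤ Γ_F` (the inertia group) with
`I = I^{p-1}·(I ∩ H)` and (μ) `μ_p(F̄^I) = 1`; `q = r^{p^k} ∈ F` with `n ↦ q^n` injective and `r ∉ F^p`; `t ∈ F̄` fixed by `I`;
`Ψ : F̄^× → M` additive into a `Γ_F`-module, kernel `q^ℤ`, TWISTED equivariance `σ·Ψ(u) = ±Ψ(σu)` (sign `+` iff `σ t = t`). For `P = Ψ(u)`
`H`-fixed with `p^n P = O` (so `u^{p^n} = q^m`):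
* CASE B (`H` fixes `t`): `σu/u ∈ q^ℤ ∩ μ = 1` for `σ ∈ H`, so `u` is `H`-fixed, and the Kummer lemmas of bsd-stepL
  (`TateTorsionRigidity.pow_prime_ne_algebraMap_of_fixed`, `mem_zpowers_of_pow_prime_pow_eq_zpow`) give `u ∈ r^ℤ`: `P ∈ ℤ·Ψ(r)`.
* CASE A (some `τ₀ ∈ H` has `τ₀ t ≠ t`): `Ψ(u·τ₀u) = O` gives `2m ∈ p^n ℤ`, so (`p` odd) `u = ζ q^{m'}` with `ζ^{p^n} = 1`, `P = Ψ(ζ)`; every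
  `h ∈ H` fixing `t` fixes `ζ` (as in Case B); writing `σ ∈ I` as `σ₁^{p-1} h` and using `σ₁^{p-1} ζ_p = ζ_p^{c^{p-1}} = ζ_p` (Fermat), a
  primitive `p`-th root of unity among the powers of `ζ` would be `I`-fixed, contradicting (μ). Hence `ζ = 1`, `P = O`.

* §1 `exists_valuation_eq_coe`, `pow_dvd_of_pow_eq`, `exists_pow_eq_and_forall_pow_ne` (`q = r^{p^k}`, `r ∉ K_𝔮^p`, for `0 < |q|_𝔮 < 1`),
  `zpow_algebraMap_injective` — valuation bookkeeping in the completion `K_𝔮` of a number field.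
* §2 `exists_eq_pow_mul_of_mem_absInertia` — `I_F = I_F^n·(I_F ∩ ker f)` for `f : Γ_F → ℤ_p` continuous and `n` a `p`-adic unit (`f(I_F)` is
  compact, hence closed, hence a `ℤ_p`-submodule: `ℕ` is dense in `ℤ_p`).
* §3 **`mem_zmultiples_of_fixed_of_twisted`** — the statement above.

HONEST FRAMING: field/group-theoretic bookkeeping over tree theorems; nothing about any curve; no registered stub, crux or summit statement is
proved by this file; closes: none.

References: [SilvermanATAEC1994] Lemma V.5.2, Thm. V.5.3, Cor. V.5.4 (PDF pp. 406–410); [Castella2018Erratum] Lemma 2.1, Remark (2) (p. 2);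
[Washington1997] §13.1; [SerreLocalFields1979] Ch. IV §4 Prop. 17 (`ℚ_p(ζ_p)/ℚ_p` totally ramified — the content of (μ)).
-/

noncomputable section

-- D-0017: single-problem summit, the namespace repeats the problem name by design.
set_option linter.dupNamespace false
set_option autoImplicit false

open scoped Classical
open Field IsDedekindDomain NumberField WeierstrassCurve
open Literature.NumberTheory.GaloisRepresentations Literature.NumberTheory.EllipticCurves
  Literature.NumberTheory.EllipticCurves.BigGaloisRep

namespace Summit.BirchSwinnertonDyer.BirchSwinnertonDyer.Theorems.TelescopeK2TwistedTateKummer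

variable {K : Type} [Field K] [NumberField K] {p : ℕ} [hp : Fact p.Prime]

/-! ## §1 Valuation bookkeeping in `K_𝔮`: `q = r^{p^k}` with `r ∉ K_𝔮^p`, and `n ↦ q^n` injective -/

omit hp in
/-- `|q|_𝔮 = ord(N)` with `N ≠ 0` for `q ∈ K_𝔮` with `0 < |q|_𝔮 < 1` (the value group is `ℤ`). [folklore] -/
theorem exists_valuation_eq_coe (𝔮 : HeightOneSpectrum (𝓞 K)) {q : 𝔮.adicCompletion K} (hq0 : q ≠ 0) (hq1 : Valued.v q < 1) :
    ∃ N : ℤ, (Valued.v q : WithZero (Multiplicative ℤ)) = ((Multiplicative.ofAdd N : Multiplicative ℤ) : WithZero (Multiplicative ℤ)) ∧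
      N ≠ 0 := by
  have hvq0 : (Valued.v q : WithZero (Multiplicative ℤ)) ≠ 0 := (Valuation.ne_zero_iff _).2 hq0
  obtain ⟨a, ha⟩ := WithZero.ne_zero_iff_exists.1 hvq0
  refine ⟨Multiplicative.toAdd a, by rw [ofAdd_toAdd, ha], fun hN => ?_⟩
  have ha1 : a = 1 := by rw [← ofAdd_toAdd a, hN]; rfl
  rw [ha1, WithZero.coe_one] at ha
  exact (lt_irrefl _) (ha ▸ hq1)

/-- **Bounded `p`-power divisibility**: for `q ∈ K_𝔮` with `0 < |q|_𝔮 < 1`, if `s^{p^j} = q` then `p^j ∣ ord_𝔮 q ≠ 0`. [folklore] -/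
theorem pow_dvd_of_pow_eq (𝔮 : HeightOneSpectrum (𝓞 K)) {q : 𝔮.adicCompletion K} (hq0 : q ≠ 0) {N : ℤ}
    (hN : (Valued.v q : WithZero (Multiplicative ℤ)) = ((Multiplicative.ofAdd N : Multiplicative ℤ) : WithZero (Multiplicative ℤ)))
    {j : ℕ} {s : 𝔮.adicCompletion K} (hs : s ^ p ^ j = q) : (p ^ j : ℤ) ∣ N := by
  have hs0 : s ≠ 0 := by
    rintro rfl
    rw [zero_pow (pow_ne_zero _ hp.out.ne_zero)] at hs
    exact hq0 hs.symm
  have hvs0 : (Valued.v s : WithZero (Multiplicative ℤ)) ≠ 0 := (Valuation.ne_zero_iff _).2 hs0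
  obtain ⟨b, hb⟩ := WithZero.ne_zero_iff_exists.1 hvs0
  have h : (Valued.v s : WithZero (Multiplicative ℤ)) ^ p ^ j = Valued.v q := by rw [← map_pow, hs]
  rw [hN, ← hb, ← WithZero.coe_pow, WithZero.coe_inj] at h
  refine ⟨Multiplicative.toAdd b, ?_⟩
  have h' := congrArg Multiplicative.toAdd h
  rw [toAdd_pow, toAdd_ofAdd, nsmul_eq_mul, Nat.cast_pow] at h'
  exact h'.symm

/-- **`q = r^{p^k}` with `r` not a `p`-th power in `K_𝔮`**, for `0 < |q|_𝔮 < 1` (take `k` maximal: `s^{p^j} = q` forces `p^j ∣ ord_𝔮 q ≠ 0`).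
[folklore] [cite: SilvermanATAEC1994, Thm. V.5.3 (the Tate parameter `q`, `|q| < 1`)] -/
theorem exists_pow_eq_and_forall_pow_ne (𝔮 : HeightOneSpectrum (𝓞 K)) {q : 𝔮.adicCompletion K} (hq0 : q ≠ 0)
    (hq1 : Valued.v q < 1) :
    ∃ (k : ℕ) (r : 𝔮.adicCompletion K), r ^ p ^ k = q ∧ ∀ s : 𝔮.adicCompletion K, s ^ p ≠ r := by
  by_contra! h
  -- then `q` has `p^j`-th roots for every `j`
  have hall : ∀ j : ℕ, ∃ s : 𝔮.adicCompletion K, s ^ p ^ j = q := by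
    intro j
    induction j with
    | zero => exact ⟨q, by rw [pow_zero, pow_one]⟩
    | succ j ih =>
      obtain ⟨s, hs⟩ := ih
      obtain ⟨t, ht⟩ := h j s hs
      exact ⟨t, by rw [pow_succ', pow_mul, ht, hs]⟩
  obtain ⟨N, hN, hN0⟩ := exists_valuation_eq_coe 𝔮 hq0 hq1
  obtain ⟨s, hs⟩ := hall N.natAbs
  have hdvd := pow_dvd_of_pow_eq (p := p) 𝔮 hq0 hN hs
  have hle : p ^ N.natAbs ≤ N.natAbs := Nat.le_of_dvd (Int.natAbs_pos.2 hN0) (by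
    have := Int.natAbs_dvd_natAbs.2 hdvd
    rwa [Int.natAbs_pow, Int.natAbs_natCast] at this)
  exact absurd hle (not_le.2 (Nat.lt_pow_self hp.out.one_lt))

omit hp in
/-- **`n ↦ q^n` is injective** on `ℤ` for `q ∈ K_𝔮` with `0 < |q|_𝔮 < 1` (read in `K̄_𝔮`). [folklore] -/
theorem zpow_algebraMap_injective (𝔮 : HeightOneSpectrum (𝓞 K)) {q : 𝔮.adicCompletion K} (hq0 : q ≠ 0) (hq1 : Valued.v q < 1) :
    Function.Injective fun z : ℤ => (algebraMap (𝔮.adicCompletion K) (AlgebraicClosure (𝔮.adicCompletion K)) q) ^ z := by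
  intro i j hij
  have hq0' : algebraMap (𝔮.adicCompletion K) (AlgebraicClosure (𝔮.adicCompletion K)) q ≠ 0 := (map_ne_zero _).2 hq0
  have h1 : (algebraMap (𝔮.adicCompletion K) (AlgebraicClosure (𝔮.adicCompletion K)) q) ^ (i - j) = 1 := by
    rw [zpow_sub₀ hq0', div_eq_one_iff_eq (zpow_ne_zero _ hq0')]
    exact hij
  rw [← map_zpow₀, ← map_one (algebraMap (𝔮.adicCompletion K) (AlgebraicClosure (𝔮.adicCompletion K)))] at h1
  have h2 : q ^ (i - j) = 1 := (algebraMap (𝔮.adicCompletion K) (AlgebraicClosure (𝔮.adicCompletion K))).injective h1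
  have h3 : (Valued.v q : WithZero (Multiplicative ℤ)) ^ (i - j) = 1 := by rw [← map_zpow₀, h2, map_one]
  obtain ⟨N, hN, hN0⟩ := exists_valuation_eq_coe 𝔮 hq0 hq1
  rw [hN, ← WithZero.coe_zpow, ← WithZero.coe_one, WithZero.coe_inj] at h3
  have h4 := congrArg Multiplicative.toAdd h3
  rw [toAdd_zpow, toAdd_ofAdd, toAdd_one, smul_eq_mul, mul_eq_zero] at h4
  rcases h4 with h | h
  · exact sub_eq_zero.1 h
  · exact absurd h hN0

/-! ## §2 The inertia group modulo `ker f`: `I = I^n · (I ∩ ker f)` for `n` a `p`-adic unit -/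

/-- **`σ = σ₁^n · h` with `σ₁ ∈ I_F`, `h ∈ I_F ∩ ker f`**, for `σ ∈ I_F`, `f : Γ_F → ℤ_p` continuous and `n` a unit of `ℤ_p`: the image
`f(I_F)` is compact, hence closed in `ℤ_p`, hence stable under multiplication by `p`-adic integers (`ℕ` is dense in `ℤ_p`), so
`n⁻¹ · f(σ) ∈ f(I_F)`. [folklore] [cite: Washington1997, §13.1] -/
theorem exists_eq_pow_mul_of_mem_absInertia (F : Type) [Field F] [ValuativeRel F] [TopologicalSpace F] [IsNonarchimedeanLocalField F]
    (f : absoluteGaloisGroup F →ₜ* Multiplicative ℤ_[p]) {n : ℕ} (hn : IsUnit (n : ℤ_[p])) {σ : absoluteGaloisGroup F}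
    (hσ : σ ∈ absInertia F) :
    ∃ σ₁ ∈ absInertia F, ∃ h ∈ absInertia F, f h = 1 ∧ σ = σ₁ ^ n * h := by
  haveI : CompactSpace (absoluteGaloisGroup F) := absoluteGaloisGroup_compactSpace F
  set B : Set (Multiplicative ℤ_[p]) := f '' (absInertia F : Set (absoluteGaloisGroup F)) with hB
  have hBclosed : IsClosed B := ((isClosed_absInertia_holds F).isCompact.image (map_continuous f)).isClosed
  obtain ⟨c, hc⟩ := hn.exists_left_inv
  -- `a ↦ a · f(σ)` maps `ℕ` into `B`, hence all of `ℤ_p`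
  let φ : ℤ_[p] → Multiplicative ℤ_[p] := fun a => Multiplicative.ofAdd (a * Multiplicative.toAdd (f σ))
  have hφ : Continuous φ := continuous_ofAdd.comp (continuous_id.mul continuous_const)
  have hφnat : ∀ m : ℕ, φ m ∈ B := fun m => ⟨σ ^ m, (absInertia F).pow_mem hσ m, by
    change f (σ ^ m) = Multiplicative.ofAdd ((m : ℤ_[p]) * Multiplicative.toAdd (f σ))
    rw [map_pow, ← nsmul_eq_mul, ofAdd_nsmul, ofAdd_toAdd]⟩
  have hφc : φ c ∈ B := by
    have hsub : Set.range (Nat.cast : ℕ → ℤ_[p]) ⊆ φ ⁻¹' B := by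
      rintro _ ⟨m, rfl⟩
      exact hφnat m
    have hcl : closure (Set.range (Nat.cast : ℕ → ℤ_[p])) ⊆ φ ⁻¹' B :=
      (hBclosed.preimage hφ).closure_subset_iff.2 hsub
    have hc' : c ∈ closure (Set.range (Nat.cast : ℕ → ℤ_[p])) := by
      rw [(PadicInt.denseRange_natCast (p := p)).closure_range]
      exact Set.mem_univ c
    exact hcl hc'
  obtain ⟨σ₁, hσ₁, hfσ₁⟩ := hφc
  refine ⟨σ₁, hσ₁, (σ₁ ^ n)⁻¹ * σ, (absInertia F).mul_mem ((absInertia F).inv_mem ((absInertia F).pow_mem hσ₁ n)) hσ, ?_,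
    (mul_inv_cancel_left _ _).symm⟩
  have h1 : f (σ₁ ^ n) = f σ := by
    rw [map_pow, hfσ₁]
    change Multiplicative.ofAdd (c * Multiplicative.toAdd (f σ)) ^ n = f σ
    rw [← ofAdd_nsmul, nsmul_eq_mul, ← mul_assoc, mul_comm (n : ℤ_[p]) c, hc, one_mul, ofAdd_toAdd]
  rw [map_mul, map_inv, h1, inv_mul_cancel]

/-! ## §3 The Kummer argument behind the twisted uniformisation (abstract) -/

/-- **THE TWISTED (L1) ARGUMENT, abstract form.** `F` a field of characteristic `0`, `p` an odd prime; `H ⊴ Γ_F` with `μ_p(F̄^H) = 1`;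
`I ≤ Γ_F` with `I = I^{p-1}·(I ∩ H)` and `μ_p(F̄^I) = 1`; `q = r^{p^k} ∈ F` with `n ↦ q^n` injective and `r ∉ F^p`; `t ∈ F̄` fixed by `I`;
`Ψ : F̄^× → M` additive into a `Γ_F`-module with kernel `q^ℤ` and the TWISTED equivariance `σ·Ψ(u) = ±Ψ(σu)` (sign `+` iff `σ t = t`).
Then every `H`-fixed `p`-power-torsion value `P = Ψ(u)` is an integer multiple of `Ψ(r)` (module docstring, Cases A/B).
[cite: SilvermanATAEC1994, Thm. V.5.3, Cor. V.5.4 (PDF pp. 407–410)] [cite: Castella2018Erratum, Lemma 2.1, Remark (2) (p. 2)] -/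
theorem mem_zmultiples_of_fixed_of_twisted {F : Type*} [Field F] [CharZero F] {M : Type*} [AddCommGroup M]
    [DistribMulAction (absoluteGaloisGroup F) M] (hp2 : p ≠ 2)
    (H : Subgroup (absoluteGaloisGroup F)) [H.Normal]
    (hμH : ∀ ζ : AlgebraicClosure F, (∀ τ ∈ H, τ • ζ = ζ) → ζ ^ p = 1 → ζ = 1)
    (I : Subgroup (absoluteGaloisGroup F))
    (hIdiv : ∀ σ ∈ I, ∃ σ₁ ∈ I, ∃ h ∈ I, h ∈ H ∧ σ = σ₁ ^ (p - 1) * h)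
    (hμI : ∀ ζ : AlgebraicClosure F, (∀ σ ∈ I, σ • ζ = ζ) → ζ ^ p = 1 → ζ = 1)
    {q r : F} (hq0 : q ≠ 0) (hqinj : Function.Injective fun z : ℤ => (algebraMap F (AlgebraicClosure F) q) ^ z)
    {k : ℕ} (hrq : r ^ p ^ k = q) (hr : ∀ s : F, s ^ p ≠ r)
    {t : AlgebraicClosure F} (htI : ∀ σ ∈ I, absoluteGaloisGroup.toAlgEquiv F σ t = t)
    (Ψ : Additive (AlgebraicClosure F)ˣ →+ M)
    (hker : ∀ u : (AlgebraicClosure F)ˣ, Ψ (Additive.ofMul u) = 0 ↔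
      ∃ n : ℤ, (u : AlgebraicClosure F) = algebraMap F (AlgebraicClosure F) q ^ n)
    (hΨσ : ∀ (σ : absoluteGaloisGroup F) (u : (AlgebraicClosure F)ˣ),
      σ • Ψ (Additive.ofMul u) = (if absoluteGaloisGroup.toAlgEquiv F σ t = t then (1 : ℤ) else -1) •
        Ψ (Additive.ofMul (Units.map (absoluteGaloisGroup.toAlgEquiv F σ : AlgebraicClosure F →* AlgebraicClosure F) u)))
    (hr0' : algebraMap F (AlgebraicClosure F) r ≠ 0)
    {P : M} (hPtor : ∃ n : ℕ, p ^ n • P = 0) (hPfix : ∀ τ ∈ H, τ • P = P) (hPΨ : P ∈ Set.range Ψ) :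
    P ∈ AddSubgroup.zmultiples (Ψ (Additive.ofMul (Units.mk0 (algebraMap F (AlgebraicClosure F) r) hr0'))) := by
  classical
  have hpP : p.Prime := hp.out
  set ι := algebraMap F (AlgebraicClosure F) with hι
  have hιq0 : ι q ≠ 0 := (map_ne_zero ι).2 hq0
  set qU : (AlgebraicClosure F)ˣ := Units.mk0 (ι q) hιq0 with hqU
  set rU : (AlgebraicClosure F)ˣ := Units.mk0 (ι r) hr0' with hrU
  -- Galois action on units, through values
  have hval_map : ∀ (σ : absoluteGaloisGroup F) (w : (AlgebraicClosure F)ˣ),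
      ((Units.map (absoluteGaloisGroup.toAlgEquiv F σ : AlgebraicClosure F →* AlgebraicClosure F) w :
        (AlgebraicClosure F)ˣ) : AlgebraicClosure F) = σ • (w : AlgebraicClosure F) := fun _ _ => rfl
  have hfixι : ∀ (σ : absoluteGaloisGroup F) (x : F), σ • ι x = ι x := fun σ x =>
    (absoluteGaloisGroup.toAlgEquiv F σ).commutes x
  -- kernel in unit form
  have hzpow_val : ∀ z : ℤ, ((qU ^ z : (AlgebraicClosure F)ˣ) : AlgebraicClosure F) = ι q ^ z := fun z => by
    rw [Units.val_zpow_eq_zpow_val]; rfl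
  have hker' : ∀ w : (AlgebraicClosure F)ˣ, Ψ (Additive.ofMul w) = 0 ↔ ∃ z : ℤ, w = qU ^ z := fun w => by
    rw [hker w]
    refine ⟨fun ⟨z, hz⟩ => ⟨z, Units.ext (by rw [hz, hzpow_val])⟩, fun ⟨z, hz⟩ => ⟨z, by rw [hz, hzpow_val]⟩⟩
  have hqinj' : ∀ z : ℤ, qU ^ z = 1 → z = 0 := fun z hz => by
    have h := congrArg (fun w : (AlgebraicClosure F)ˣ => (w : AlgebraicClosure F)) hz
    simp only [hzpow_val, Units.val_one] at h
    exact hqinj (h.trans (zpow_zero _).symm)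
  have hΨqz : ∀ z : ℤ, Ψ (Additive.ofMul (qU ^ z)) = 0 := fun z => (hker' _).2 ⟨z, rfl⟩
  have hrUq : rU ^ p ^ k = qU := Units.ext (by
    rw [Units.val_pow_eq_pow_val]
    change ι r ^ p ^ k = ι q
    rw [← map_pow, hrq])
  -- the point and its lift
  obtain ⟨x, hx⟩ := hPΨ
  obtain ⟨u, rfl⟩ : ∃ u : (AlgebraicClosure F)ˣ, Additive.ofMul u = x := ⟨Additive.toMul x, rfl⟩
  have hu : Ψ (Additive.ofMul u) = P := hx
  obtain ⟨n, hn⟩ := hPtor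
  have h1 : Ψ (Additive.ofMul (u ^ p ^ n)) = 0 := by rw [ofMul_pow, map_nsmul, hu, hn]
  obtain ⟨m, hm⟩ := (hker' _).1 h1
  -- Galois elements fix `qU` and its powers; they act on `u ^ p ^ n` trivially
  have hσqU : ∀ (σ : absoluteGaloisGroup F) (z : ℤ),
      Units.map (absoluteGaloisGroup.toAlgEquiv F σ : AlgebraicClosure F →* AlgebraicClosure F) (qU ^ z) = qU ^ z :=
    fun σ z => Units.ext (by rw [hval_map, hzpow_val, ← map_zpow₀, hfixι])
  -- an `H`-element fixing `t` fixes `u`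
  have hfixu : ∀ τ ∈ H, absoluteGaloisGroup.toAlgEquiv F τ t = t →
      Units.map (absoluteGaloisGroup.toAlgEquiv F τ : AlgebraicClosure F →* AlgebraicClosure F) u = u := by
    intro τ hτ hτt
    set gu := Units.map (absoluteGaloisGroup.toAlgEquiv F τ : AlgebraicClosure F →* AlgebraicClosure F) u with hgu
    have e1 := hΨσ τ u
    rw [if_pos hτt, one_smul, hu, hPfix τ hτ] at e1
    have e2 : Ψ (Additive.ofMul (gu * u⁻¹)) = 0 := by
      rw [ofMul_mul, ofMul_inv, map_add, map_neg, ← e1, hu, add_neg_cancel]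
    obtain ⟨b, hb⟩ := (hker' _).1 e2
    have e3 : gu ^ p ^ n = u ^ p ^ n := by
      rw [hgu, ← map_pow, hm, hσqU]
    have e4 : (qU ^ b) ^ (p ^ n : ℕ) = 1 := by
      rw [← hb, mul_pow, e3, inv_pow, mul_inv_cancel]
    rw [← zpow_natCast, ← zpow_mul] at e4
    have e5 := hqinj' _ e4
    have hb0 : b = 0 := by
      rcases mul_eq_zero.1 e5 with h | h
      · exact h
      · exact absurd h (by exact_mod_cast pow_ne_zero n hpP.ne_zero)
    rw [hb0, zpow_zero] at hb
    exact mul_inv_eq_one.1 hb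
  by_cases hA : ∃ τ₀ ∈ H, absoluteGaloisGroup.toAlgEquiv F τ₀ t ≠ t
  · /- CASE A: `P = Ψ(ζ)` for a `p`-power root of unity `ζ` fixed by `I`, hence `P = 0` -/
    obtain ⟨τ₀, hτ₀, hτ₀t⟩ := hA
    set g₀ := Units.map (absoluteGaloisGroup.toAlgEquiv F τ₀ : AlgebraicClosure F →* AlgebraicClosure F) with hg₀
    have e1 := hΨσ τ₀ u
    rw [if_neg hτ₀t, neg_one_zsmul, hu, hPfix τ₀ hτ₀] at e1
    have e1' : Ψ (Additive.ofMul (g₀ u)) = -P := by rw [e1, neg_neg]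
    have e2 : Ψ (Additive.ofMul (u * g₀ u)) = 0 := by
      rw [ofMul_mul, map_add, hu, e1', add_neg_cancel]
    obtain ⟨a, ha⟩ := (hker' _).1 e2
    have e3 : (u * g₀ u) ^ (p ^ n : ℕ) = qU ^ (2 * m) := by
      rw [mul_pow, hg₀, ← map_pow, hm, hσqU, two_mul, zpow_add]
    rw [ha, ← zpow_natCast, ← zpow_mul] at e3
    have e4 : a * (p ^ n : ℕ) = 2 * m := by
      have := hqinj' (a * (p ^ n : ℕ) - 2 * m) (by rw [zpow_sub, e3, mul_inv_cancel])
      omega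
    -- `p^n ∣ m` (p odd)
    have hdvd : ((p ^ n : ℕ) : ℤ) ∣ m := by
      have h2 : ((p ^ n : ℕ) : ℤ) ∣ 2 * m := ⟨a, by rw [← e4, mul_comm]⟩
      have hcopN : Nat.Coprime (p ^ n) 2 :=
        Nat.Coprime.pow_left n ((Nat.coprime_primes hpP Nat.prime_two).2 hp2)
      have hcop : IsCoprime ((p ^ n : ℕ) : ℤ) (2 : ℤ) :=
        Int.isCoprime_iff_gcd_eq_one.2 (by rw [show (2 : ℤ) = ((2 : ℕ) : ℤ) by rfl, Int.gcd_natCast_natCast]; exact hcopN)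
      exact hcop.dvd_of_dvd_mul_left h2
    obtain ⟨m', hm'⟩ := hdvd
    set ζ : (AlgebraicClosure F)ˣ := u * (qU ^ m')⁻¹ with hζ
    have hζpow : ζ ^ p ^ n = 1 := by
      rw [hζ, mul_pow, inv_pow, hm, ← zpow_natCast (qU ^ m'), ← zpow_mul, mul_comm m', ← hm', mul_inv_cancel]
    have hPζ : P = Ψ (Additive.ofMul ζ) := by
      rw [hζ, ofMul_mul, ofMul_inv, map_add, map_neg, hu, hΨqz, neg_zero, add_zero]
    -- `ζ` is fixed by every `h ∈ H` fixing `t`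
    have hζfix : ∀ h ∈ H, absoluteGaloisGroup.toAlgEquiv F h t = t → h • (ζ : AlgebraicClosure F) = ζ := by
      intro h hh hht
      rw [← hval_map, hζ, map_mul, map_inv, hfixu h hh hht, hσqU]
    -- if `ζ ≠ 1`, a primitive `p`-th root of unity among its powers is `I`-fixed: contradiction
    have hζ1 : (ζ : AlgebraicClosure F) = 1 := by
      by_contra hne
      have hex : ∃ e : ℕ, (ζ : AlgebraicClosure F) ^ p ^ e = 1 := ⟨n, by rw [← Units.val_pow_eq_pow_val, hζpow, Units.val_one]⟩
      have hee : (ζ : AlgebraicClosure F) ^ p ^ Nat.find hex = 1 := Nat.find_spec hex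
      have he0 : Nat.find hex ≠ 0 := fun h0 => by rw [h0, pow_zero, pow_one] at hee; exact hne hee
      obtain ⟨e', he'⟩ := Nat.exists_eq_succ_of_ne_zero he0
      rw [he'] at hee
      set ζp : AlgebraicClosure F := (ζ : AlgebraicClosure F) ^ p ^ e' with hζp
      have hζpp : ζp ^ p = 1 := by rw [hζp, ← pow_mul, ← pow_succ, hee]
      have hζp1 : ζp ≠ 1 := fun h1 => Nat.find_min hex (he' ▸ Nat.lt_succ_self e') h1
      have hprim : IsPrimitiveRoot ζp p := by
        have := IsPrimitiveRoot.orderOf ζp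
        rwa [orderOf_eq_prime hζpp hζp1] at this
      have hζpH : ∀ h ∈ H, absoluteGaloisGroup.toAlgEquiv F h t = t → h • ζp = ζp := fun h hh hht => by
        rw [hζp, smul_pow', hζfix h hh hht]
      haveI : NeZero p := ⟨hpP.ne_zero⟩
      have hζpI : ∀ σ ∈ I, σ • ζp = ζp := by
        intro σ hσ
        obtain ⟨σ₁, hσ₁, h, hhI, hhH, rfl⟩ := hIdiv σ hσ
        rw [mul_smul, hζpH h hhH (htI h hhI)]
        -- `σ₁ ζp = ζp ^ c`, so `σ₁^{p-1} ζp = ζp^{c^{p-1}} = ζp`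
        obtain ⟨c, hcp, hc⟩ := hprim.eq_pow_of_pow_eq_one (ξ := σ₁ • ζp) (by rw [← smul_pow', hζpp, smul_one])
        have hiter : ∀ j : ℕ, σ₁ ^ j • ζp = ζp ^ c ^ j := by
          intro j
          induction j with
          | zero => rw [pow_zero, one_smul, pow_zero, pow_one]
          | succ j ih => rw [pow_succ, mul_smul, ← hc, smul_pow', ih, ← pow_mul, ← pow_succ]
        rw [hiter]
        have hc0 : ¬ p ∣ c := fun hpc => by
          have h1 : σ₁ • ζp = 1 := by
            rw [← hc]
            obtain ⟨d, rfl⟩ := hpc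
            rw [pow_mul, hζpp, one_pow]
          have h2 : ζp = 1 := by rw [← inv_smul_smul σ₁ ζp, h1, smul_one]
          exact hζp1 h2
        have hferm : c ^ (p - 1) ≡ 1 [MOD p] :=
          Nat.ModEq.pow_card_sub_one_eq_one hpP ((Nat.Prime.coprime_iff_not_dvd hpP).2 hc0).symm
        have hcpos : 0 < c := Nat.pos_of_ne_zero fun h0 => hc0 (h0 ▸ dvd_zero p)
        have h1le : 1 ≤ c ^ (p - 1) := Nat.one_le_pow _ _ hcpos
        obtain ⟨d, hd⟩ := (Nat.modEq_iff_dvd' h1le).1 hferm.symm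
        have hcd : c ^ (p - 1) = 1 + p * d := by omega
        rw [hcd, pow_add, pow_one, pow_mul, hζpp, one_pow, mul_one]
      exact hζp1 (hμI ζp hζpI hζpp)
    have hζone : ζ = 1 := Units.ext hζ1
    rw [hPζ, hζone, ofMul_one, map_zero]
    exact AddSubgroup.zero_mem _
  · /- CASE B: `u` is `H`-fixed, hence a power of `r` by Kummer theory -/
    push Not at hA
    let S : Subgroup (AlgebraicClosure F)ˣ :=
      { carrier := {w | ∀ τ ∈ H, τ • (w : AlgebraicClosure F) = w}
        one_mem' := fun τ _ => by rw [Units.val_one, smul_one]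
        mul_mem' := fun {a b} ha hb τ hτ => by rw [Units.val_mul, smul_mul', ha τ hτ, hb τ hτ]
        inv_mem' := fun {a} ha τ hτ => by rw [Units.val_inv_eq_inv_val, smul_inv'', ha τ hτ] }
    have hmemS : ∀ w : (AlgebraicClosure F)ˣ, w ∈ S ↔ ∀ τ ∈ H, τ • (w : AlgebraicClosure F) = w := fun _ => Iff.rfl
    have hS : ∀ g ∈ S, g ^ p = 1 → g = 1 := fun g hg hgp =>
      Units.ext (hμH g ((hmemS g).1 hg) (by rw [← Units.val_pow_eq_pow_val, hgp, Units.val_one]))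
    have hrS : rU ∈ S := (hmemS rU).2 fun τ _ => hfixι τ r
    have hrS' : ∀ s ∈ S, s ^ p ≠ rU := fun s hs hsp =>
      TateTorsionRigidity.pow_prime_ne_algebraMap_of_fixed hpP H hμH hr (s : AlgebraicClosure F) ((hmemS s).1 hs)
        (by rw [← Units.val_pow_eq_pow_val, hsp]; rfl)
    have huS : u ∈ S := (hmemS u).2 fun τ hτ => by rw [← hval_map, hfixu τ hτ (hA τ hτ)]
    have hupow : u ^ p ^ n = rU ^ ((p ^ k : ℕ) * m : ℤ) := by rw [zpow_mul, zpow_natCast, hrUq, hm]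
    obtain ⟨a, ha⟩ := Subgroup.mem_zpowers_iff.1
      (TateTorsionRigidity.mem_zpowers_of_pow_prime_pow_eq_zpow hpP S hS hrS hrS' n u huS _ hupow)
    rw [← hu, ← ha, ofMul_zpow, map_zsmul]
    exact AddSubgroup.zsmul_mem_zmultiples _ a

end Summit.BirchSwinnertonDyer.BirchSwinnertonDyer.Theorems.TelescopeK2TwistedTateKummer

end
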